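import Mathlib
import Summits.Ventures.PercRepro2.HCov
import Summits.Ventures.PercRepro2.HCovSwap
import Summits.Ventures.PercRepro2.ContractDefs
import Summits.Ventures.PercRepro2.RECMReduction
import Summits.Ventures.PercRepro2.GcTransport
import Summits.Ventures.PercRepro2.GcTransportMarks

/-!
# The parallel rule for the covariance form (blind cell PercRepro2, p1 g11; the weighted form of
LEAD-TYPED-REDUCTION §1 (b))

Two parallel edges `g₁, g₂` (`ends g₂ = ends g₁`) are one edge of weight
`p_{g₁} + p_{g₂} − p_{g₁} p_{g₂}`: **`Gc_parallel`** — `Gc p ends = Gc p′ (ends[g₂ ↦ loop])` with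
`p′ = p[g₁ ↦ p_{g₁} + p_{g₂} − p_{g₁} p_{g₂}][g₂ ↦ 0]`, through `Gc_transport` with the parallel map
`ω ↦ ω[g₁ ↦ ω_{g₁} ∨ ω_{g₂}][g₂ ↦ false]` (**`prob_parallel_pushforward`**: its law under `p` is `p′`;
**`openGraph_parallel`**: it preserves the open graph exactly). With it the induction of
`CCWReduced.lean` only ever needs (c-CW) on SIMPLE graphs (no parallel edges), the graphs of the
cell's census lists.
-/

namespace Summit.Ventures.PercRepro2

open CovForm Contract

namespace RECM

/-! ## The parallel rule: two parallel edges are one edge of weight `s₁ + s₂ − s₁ s₂` -/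

section Parallel

variable {V : Type*} {E : Type*} [Fintype E] [DecidableEq E] {R : Type*} [CommRing R]

/-- The parallel map at the edges `g₁, g₂`: `g₁` becomes open iff either was open, `g₂` is closed. -/
def parallelMap (g₁ g₂ : E) (ω : Config E) : Config E :=
  Function.update (Function.update ω g₁ (ω g₁ || ω g₂)) g₂ false

/-- **The parallel pushforward**: under `p`, `parallelMap g₁ g₂` has the law
`p[g₁ ↦ p_{g₁} + p_{g₂} − p_{g₁} p_{g₂}][g₂ ↦ 0]`. -/
theorem prob_parallel_pushforward (p : E → R) {g₁ g₂ : E} (h12 : g₁ ≠ g₂) (A : Set (Config E)) :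
    prob (Function.update (Function.update p g₁ (p g₁ + p g₂ - p g₁ * p g₂)) g₂ 0) A =
      prob p (parallelMap g₁ g₂ ⁻¹' A) := by
  rw [prob_eq_expect_indicator, prob_eq_expect_indicator]
  set g : Config E → R := A.indicator 1 with hg
  have hpre : ∀ ω, (parallelMap g₁ g₂ ⁻¹' A).indicator (1 : Config E → R) ω =
      g (parallelMap g₁ g₂ ω) := by
    intro ω
    by_cases h : parallelMap g₁ g₂ ω ∈ A
    · have h' : ω ∈ parallelMap g₁ g₂ ⁻¹' A := h
      simp only [hg, Set.indicator_of_mem h, Set.indicator_of_mem h', Pi.one_apply]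
    · have h' : ω ∉ parallelMap g₁ g₂ ⁻¹' A := h
      simp only [hg, Set.indicator_of_notMem h, Set.indicator_of_notMem h']
  rw [show (parallelMap g₁ g₂ ⁻¹' A).indicator (1 : Config E → R) =
    fun ω => g (parallelMap g₁ g₂ ω) from funext hpre]
  -- the left side: pin `g₁` (the weight of `g₂` is `0`)
  have hL : expect (Function.update (Function.update p g₁ (p g₁ + p g₂ - p g₁ * p g₂)) g₂ 0) g =
      (p g₁ + p g₂ - p g₁ * p g₂) * expect (Function.update (Function.update p g₁ 1) g₂ 0) g +
        (1 - (p g₁ + p g₂ - p g₁ * p g₂)) * expect (Function.update (Function.update p g₁ 0) g₂ 0) g := by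
    rw [expect_eq_pin _ g g₁, Function.update_comm h12.symm, Function.update_idem,
      Function.update_comm h12.symm, Function.update_idem, Function.update_of_ne h12,
      Function.update_self]
  -- the right side: pin `g₂`, then `g₁`
  have hR1 : expect (Function.update p g₂ 1) (fun ω => g (parallelMap g₁ g₂ ω)) =
      expect (Function.update (Function.update p g₁ 1) g₂ 0) g := by
    rw [expect_congr_support _ (g' := fun ω => g (Function.update (Function.update ω g₁ true) g₂ false))]
    · have step1 := expect_update_one (Function.update p g₂ 1)
        (fun ω' => g (Function.update ω' g₂ false)) g₁
      have step2 := expect_update_zero (Function.update (Function.update p g₂ 1) g₁ 1) g g₂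
      rw [show (fun ω => g (Function.update (Function.update ω g₁ true) g₂ false)) =
        fun ω => (fun ω' => g (Function.update ω' g₂ false)) (Function.update ω g₁ true) from rfl,
        ← step1, ← step2, Function.update_comm h12.symm, Function.update_idem]
    · intro ω hw
      have h2 : ω g₂ = true := eq_true_of_weight_update_one_ne_zero _ g₂ hw
      simp only [parallelMap, h2, Bool.or_true]
  have hR2 : expect (Function.update p g₂ 0) (fun ω => g (parallelMap g₁ g₂ ω)) =
      expect (Function.update p g₂ 0) g := by
    rw [expect_congr_support _ (g' := g)]
    intro ω hw
    have h2 : ω g₂ = false := eq_false_of_weight_update_zero_ne_zero _ g₂ hw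
    simp only [parallelMap, h2, Bool.or_false, Function.update_eq_self]
    rw [show Function.update ω g₂ false = ω from Function.update_eq_self_iff.mpr h2.symm]
  rw [hL, expect_eq_pin p _ g₂, hR1, hR2, expect_eq_pin (Function.update p g₂ 0) g g₁,
    Function.update_of_ne h12, Function.update_comm h12.symm, Function.update_comm h12.symm]
  ring

omit [Fintype E] in
/-- With `g₂` parallel to `g₁`, the open graph of `ω` is the open graph of the parallel
configuration on the graph with `g₂` re-routed to a loop. -/
lemma openGraph_parallel {ends : E → Sym2 V} {g₁ g₂ : E} (h12 : g₁ ≠ g₂) (hpar : ends g₂ = ends g₁)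
    (u : V) (ω : Config E) :
    openGraph (Function.update ends g₂ s(u, u)) (parallelMap g₁ g₂ ω) = openGraph ends ω := by
  ext x z
  simp only [openGraph_adj, OpenAdj]
  constructor
  · rintro ⟨hxz, f, hf, hends⟩
    refine ⟨hxz, ?_⟩
    by_cases hf2 : f = g₂
    · subst hf2
      rw [Function.update_self, Sym2.eq_iff] at hends
      exact absurd (by rcases hends with ⟨h1, h2⟩ | ⟨h1, h2⟩ <;> rw [← h1, ← h2]) hxz
    rw [Function.update_of_ne hf2] at hends
    by_cases hf1 : f = g₁
    · subst hf1
      simp only [parallelMap, Function.update_of_ne h12, Function.update_self, Bool.or_eq_true] at hf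
      rcases hf with h | h
      · exact ⟨f, h, hends⟩
      · exact ⟨g₂, h, hpar.trans hends⟩
    · rw [parallelMap, Function.update_of_ne hf2, Function.update_of_ne hf1] at hf
      exact ⟨f, hf, hends⟩
  · rintro ⟨hxz, f, hf, hends⟩
    refine ⟨hxz, ?_⟩
    by_cases hf2 : f = g₂
    · subst hf2
      refine ⟨g₁, ?_, ?_⟩
      · simp [parallelMap, Function.update_of_ne h12, hf]
      · rw [Function.update_of_ne h12, ← hpar, hends]
    by_cases hf1 : f = g₁
    · subst hf1
      refine ⟨f, ?_, ?_⟩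
      · simp [parallelMap, Function.update_of_ne h12, hf]
      · rw [Function.update_of_ne h12, hends]
    · refine ⟨f, ?_, ?_⟩
      · rw [parallelMap, Function.update_of_ne hf2, Function.update_of_ne hf1]
        exact hf
      · rw [Function.update_of_ne hf2, hends]

end Parallel

section ParallelRule

variable {V : Type*} {E : Type*} [Fintype E] [DecidableEq E] [DecidableEq V] {R : Type*}
  [Field R] [LinearOrder R]

omit [DecidableEq V] [LinearOrder R] in
/-- **The parallel rule**: two parallel edges `g₁, g₂` are one edge `g₁` of weight
`p_{g₁} + p_{g₂} − p_{g₁} p_{g₂}` with `g₂` re-routed to a loop. -/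
theorem Gc_parallel (p : E → R) {ends : E → Sym2 V} {g₁ g₂ : E} (h12 : g₁ ≠ g₂)
    (hpar : ends g₂ = ends g₁) (u : V) (o a₁ a₂ a₃ b : V) :
    Gc p ends o a₁ a₂ a₃ b =
      Gc (Function.update (Function.update p g₁ (p g₁ + p g₂ - p g₁ * p g₂)) g₂ 0)
        (Function.update ends g₂ s(u, u)) o a₁ a₂ a₃ b :=
  (Gc_transport (φ := id) (prob_parallel_pushforward p h12)
    (fun ω x z => by unfold Conn; rw [openGraph_parallel h12 hpar u ω]; exact Iff.rfl)
    o a₁ a₂ a₃ b).symm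

end ParallelRule

end RECM

end Summit.Ventures.PercRepro2
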